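import Literature.AlgebraicGeometry.Modules.PushforwardClosedImmersionFullyFaithful
import Literature.AlgebraicGeometry.Modules.LinearOverBase
import Mathlib.CategoryTheory.Limits.Preserves.Shapes.Kernels
import Mathlib.CategoryTheory.Adjunction.FullyFaithful
import Mathlib.CategoryTheory.Adjunction.Limits
import HarnessLib

/-!
# Inverse image along `ι : Z → X` of a module and of its quotient `F/aF`, `ι♯(a) = 0`

Let `ι : Z → X` be a morphism of schemes and `a ∈ Γ(X, 𝒪_X)` a global function with `ι♯(a) = 0`
(e.g. a thickening `X ⊗_A A/(a) → X`). For ANY `𝒪_X`-module `F`: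

* `pullback_map_globalScalar` — **`ι^*` is linear over `ι♯`**: `ι^*(a · ) = ι♯(a) ·` on `ι^*F`
  (multiplication by a global function, `Modules/LinearOverBase.globalScalar`; proof by transposing
  along `ι^* ⊣ ι_*`, on whose right-hand side `Γ(V, ι_*G) = Γ(ι⁻¹V, G)` the statement is `rfl`);
  hence `ι^*(a · ) = 0` when `ι♯(a) = 0` (`pullback_map_globalScalar_eq_zero`);
* `pullbackCokernelGlobalScalarIso` — **`ι^*(F/aF) ≅ ι^*F`** canonically (`ι^*` is a left adjoint,
  so it preserves the cokernel, which becomes the cokernel of `0`), compatibly with the projection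
  (`map_cokernel_π_pullbackCokernelGlobalScalarIso_hom`);
* `pullbackIsoOfCokernelIso` — for `ι` a CLOSED IMMERSION: **if `F/aF ≅ ι_*E` for an `𝒪_Z`-module
  `E`, then `ι^*F ≅ E`** (`ι^*(F/aF) ≅ ι^*ι_*E ≅ E`, the counit being an isomorphism because `ι_*` is
  fully faithful, `Modules/PushforwardClosedImmersionFullyFaithful.lean`).

This is the passage from the "quotient" description `F ↦ (F/aⁿ⁺¹F)_n` of the formal completion of a
module along `V(a)` (Görtz–Wedhorn II (24.18.1); the tree's `Morphisms/FormalFunctionsModule*`) to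
the "restriction" description `F ↦ (ι_n^*F)_n` by inverse images to the thickenings
(`FormalGeometry/TowerModule.completion`, `Motives/GrothendieckExistenceWitt`): a levelwise
identification `F/aⁿ⁺¹F ≅ ι_{n*}E_n` yields `ι_n^*F ≅ E_n`, for every `F` (no finiteness needed).
Everything is proved; no named facts.

## References

* U. Görtz, T. Wedhorn, *Algebraic Geometry II*, Springer Spektrum (2023), (24.18.1) and Rem. 24.86
  (p. 562): `ℱ_{/Z} = (ℱ/𝒥ⁿ⁺¹ℱ)_n = (i_n^*ℱ)_n`. [GortzWedhorn2023]
* The Stacks Project, Tag 08KS (Modules, Lemma 17.13.4: `i^*i_*𝓖 = 𝓖`, `i_*i^*𝓕 = 𝓕/𝓘𝓕`).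
  [StacksProject]
-/

noncomputable section

open CategoryTheory AlgebraicGeometry Limits TopologicalSpace Opposite

universe u

namespace Literature.AlgebraicGeometry.Modules

variable {Z X : Scheme.{u}} (ι : Z ⟶ X)

/-! ## `ι^*` is linear over `ι♯` -/

/-- `ι_*(ι♯(a) · ) = a ·` on a direct image (on `Γ(V, ι_*P) = Γ(ι⁻¹V, P)` both sides are
multiplication by `ι♯(a)|_{ι⁻¹V}`); private copy of
`Modules/PushforwardClosedImmersionExact.pushforward_map_globalScalar`. [folklore] -/
private theorem pushforward_map_globalScalar' (P : Z.Modules) (a : Γ(X, ⊤)) :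
    (Scheme.Modules.pushforward ι).map (globalScalar P (ι.appTop a)) =
      globalScalar ((Scheme.Modules.pushforward ι).obj P) a := by
  refine Scheme.Modules.hom_ext _ _ fun V => ?_
  ext s
  change (globalScalar P (ι.appTop a)).app (ι ⁻¹ᵁ V) s =
    (globalScalar ((Scheme.Modules.pushforward ι).obj P) a).app V s
  rw [globalScalar_app_apply, globalScalar_app_apply]
  change Z.presheaf.map (homOfLE (le_top : ι ⁻¹ᵁ V ≤ ⊤)).op (ι.appTop a) •
      (show Γ(P, ι ⁻¹ᵁ V) from s) =
    ι.app V (X.presheaf.map (homOfLE (le_top : V ≤ ⊤)).op a) • (show Γ(P, ι ⁻¹ᵁ V) from s)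
  congr 1
  have h' := congrArg (fun φ => φ.hom a) (ι.naturality (homOfLE (le_top : V ≤ ⊤)).op)
  exact h'.symm

/-- **`ι^*(a · ) = ι♯(a) ·`**: the inverse image of multiplication by a global function `a` on `F`
is multiplication by `ι♯(a)` on `ι^*F` (transpose along `ι^* ⊣ ι_*` and use the statement for
`ι_*`, where it holds on the nose). [folklore] -/
theorem pullback_map_globalScalar (F : X.Modules) (a : Γ(X, ⊤)) :
    (Scheme.Modules.pullback ι).map (globalScalar F a) =
      globalScalar ((Scheme.Modules.pullback ι).obj F) (ι.appTop a) := by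
  have key : ∀ (G : Z.Modules) (ψ : (Scheme.Modules.pullback ι).obj F ⟶ G),
      (Scheme.Modules.pullback ι).map (globalScalar F a) ≫ ψ =
        globalScalar ((Scheme.Modules.pullback ι).obj F) (ι.appTop a) ≫ ψ := by
    intro G ψ
    apply ((Scheme.Modules.pullbackPushforwardAdjunction ι).homEquiv F G).injective
    rw [Adjunction.homEquiv_naturality_left, globalScalar_comp, ← pushforward_map_globalScalar',
      ← Adjunction.homEquiv_naturality_right, ← globalScalar_comp]
  simpa only [Category.comp_id] using key _ (𝟙 _)

/-- Hence `ι^*(a · ) = 0` on `ι^*F` when `ι♯(a) = 0`. [folklore] -/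
theorem pullback_map_globalScalar_eq_zero (F : X.Modules) {a : Γ(X, ⊤)} (ha : ι.appTop a = 0) :
    (Scheme.Modules.pullback ι).map (globalScalar F a) = 0 := by
  rw [pullback_map_globalScalar, ha, globalScalar_zero]

/-! ## `ι^*(F/aF) ≅ ι^*F` -/

/-- **`ι^*(F/aF) ≅ ι^*F` for `ι♯(a) = 0`**: `ι^*` preserves the cokernel (left adjoint), which is the
cokernel of `ι^*(a · ) = 0`. [cite: GortzWedhorn2023, (24.18.1) and Rem. 24.86 (p. 562)] -/
def pullbackCokernelGlobalScalarIso (F : X.Modules) {a : Γ(X, ⊤)} (ha : ι.appTop a = 0) :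
    (Scheme.Modules.pullback ι).obj (cokernel (globalScalar F a)) ≅
      (Scheme.Modules.pullback ι).obj F :=
  PreservesCokernel.iso (Scheme.Modules.pullback ι) (globalScalar F a) ≪≫
    cokernelIsoOfEq (pullback_map_globalScalar_eq_zero ι F ha) ≪≫ cokernelZeroIsoTarget

/-- Compatibility with the projection: `ι^*(π) ≫ ≅ = 𝟙`. [folklore] -/
@[reassoc]
theorem map_cokernel_π_pullbackCokernelGlobalScalarIso_hom (F : X.Modules) {a : Γ(X, ⊤)}
    (ha : ι.appTop a = 0) :
    (Scheme.Modules.pullback ι).map (cokernel.π (globalScalar F a)) ≫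
        (pullbackCokernelGlobalScalarIso ι F ha).hom = 𝟙 _ := by
  rw [pullbackCokernelGlobalScalarIso, Iso.trans_hom, Iso.trans_hom,
    PreservesCokernel.π_iso_hom_assoc, π_comp_cokernelIsoOfEq_hom_assoc, cokernelZeroIsoTarget_hom,
    cokernel.π_desc]

/-- Equivalently `≅⁻¹ = ι^*(π)`. [folklore] -/
theorem pullbackCokernelGlobalScalarIso_inv (F : X.Modules) {a : Γ(X, ⊤)} (ha : ι.appTop a = 0) :
    (pullbackCokernelGlobalScalarIso ι F ha).inv =
      (Scheme.Modules.pullback ι).map (cokernel.π (globalScalar F a)) := by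
  rw [← cancel_mono (pullbackCokernelGlobalScalarIso ι F ha).hom, Iso.inv_hom_id,
    map_cokernel_π_pullbackCokernelGlobalScalarIso_hom]

/-! ## From `F/aF ≅ ι_*E` to `ι^*F ≅ E` for a closed immersion -/

variable [IsClosedImmersion ι]

/-- **`ι^*ι_*E ≅ E` for a closed immersion**: the counit of `ι^* ⊣ ι_*` is an isomorphism because
`ι_*` is fully faithful (`Modules/PushforwardClosedImmersionFullyFaithful.lean`; Mathlib
`Adjunction.counit_isIso_of_R_fully_faithful`). [cite: StacksProject, Tag 08KS (Modules, Lemma 17.13.4)] -/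
def counitIso (E : Z.Modules) :
    (Scheme.Modules.pullback ι).obj ((Scheme.Modules.pushforward ι).obj E) ≅ E :=
  (asIso ((Scheme.Modules.pullbackPushforwardAdjunction ι).counit.app E) :)

/-- `counitIso` is the counit. [folklore] -/
@[simp]
theorem counitIso_hom (E : Z.Modules) :
    (counitIso ι E).hom = (Scheme.Modules.pullbackPushforwardAdjunction ι).counit.app E := rfl

/-- **If `F/aF ≅ ι_*E` then `ι^*F ≅ E`** (`ι` a closed immersion with `ι♯(a) = 0`, `F` any
`𝒪_X`-module, `E` any `𝒪_Z`-module): `ι^*F ≅ ι^*(F/aF) ≅ ι^*ι_*E ≅ E`, the last by the counit,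
an isomorphism since `ι_*` is fully faithful. [cite: StacksProject, Tag 08KS (Modules, Lemma 17.13.4)] -/
def pullbackIsoOfCokernelIso (F : X.Modules) {a : Γ(X, ⊤)} (ha : ι.appTop a = 0) {E : Z.Modules}
    (β : cokernel (globalScalar F a) ≅ (Scheme.Modules.pushforward ι).obj E) :
    (Scheme.Modules.pullback ι).obj F ≅ E :=
  (pullbackCokernelGlobalScalarIso ι F ha).symm ≪≫ (Scheme.Modules.pullback ι).mapIso β ≪≫
    counitIso ι E

/-- The isomorphism `pullbackIsoOfCokernelIso` is the transpose of `F → F/aF ≅ ι_*E`: its adjoint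
`F → ι_*E` is `π ≫ β`. [folklore] -/
theorem homEquiv_pullbackIsoOfCokernelIso_hom (F : X.Modules) {a : Γ(X, ⊤)} (ha : ι.appTop a = 0)
    {E : Z.Modules} (β : cokernel (globalScalar F a) ≅ (Scheme.Modules.pushforward ι).obj E) :
    (Scheme.Modules.pullbackPushforwardAdjunction ι).homEquiv F E
        (pullbackIsoOfCokernelIso ι F ha β).hom =
      cokernel.π (globalScalar F a) ≫ β.hom := by
  rw [pullbackIsoOfCokernelIso, Iso.trans_hom, Iso.trans_hom, Iso.symm_hom,
    pullbackCokernelGlobalScalarIso_inv, Functor.mapIso_hom, counitIso_hom, ← Functor.map_comp_assoc,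
    Adjunction.homEquiv_naturality_left, Adjunction.homEquiv_unit]
  have h := (Scheme.Modules.pullbackPushforwardAdjunction ι).right_triangle_components E
  exact (congrArg (fun φ => (cokernel.π (globalScalar F a) ≫ β.hom) ≫ φ) h).trans
    (Category.comp_id _)

end Literature.AlgebraicGeometry.Modules

end
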